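import Summits.HubbardSuperconductivity.HubbardLadder.DWaveFormFactorSumLower
import Summits.HubbardSuperconductivity.HubbardLadder.DWavePairFieldKinematicCeiling
import Summits.HubbardSuperconductivity.HubbardSuperconductivity.Theorems.ThermalWedgeTwTipContinuationEdgeOrderBCSExpectations
import HarnessLib

/-!
# The iso-gap `d`-wave BCS product state attains the kinematic ceiling `128/π⁴` (Fock space)

pub-hubbard r3 — part 2 of 3 of the SHARPNESS complement to rung 0′ of the R4 ceiling ladder (R4-MEMO
§9.13; parts: `DWaveFormFactorSumLower` → this file → `DWavePairFieldKinematicCeilingSharp`). HONEST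
FRAMING: ladder R1–R4 with certified numbers; no claim on H/H₀. NEW cell-side mathematics (not a published
result), staged by the r3 planner seat for a prover/librarian seat. KINEMATIC CALIBRATION ONLY — not a
booked rung, ladder tallies unchanged, no numerics (imports only landed modules and part 1: the rung-0′ file
`DWavePairFieldKinematicCeiling` and the landed BCS product-state calculus
`…ThermalWedgeTwTipContinuationEdgeOrderBCSExpectations`).

CONTENT. Rung 0′ (`pairFieldDensity_le_kinematic`): for EVERY unit state of the spin-½ fermion torus
`(ℤ/Lℤ)²`, `p_d(L; ψ) = L⁻⁴ Re⟨ψ, Δ_d†Δ_d ψ⟩ ≤ 8(4/π² + 18/L)²`, so `limsup ≤ 128/π⁴` for every admissible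
ground-state sequence of every Hamiltonian. This file proves the constant is ATTAINED in Fock space:
* §2 the **iso-gap `d`-wave BCS product state** `isoBCSState L = Π_k (u + v_k b_k†)|0⟩`, `u = 1/√2`,
  `v_k = sgn ĝ_d(k)/√2` (unit: `isoBCSState_norm`; spin-balanced: `isoBCSState_mem_spinBalanced`); since
  `Δ_d†Δ_d = 8 B†B`, `B = Σ_k ĝ_d(k) b_k` (`conjTranspose_pairField_dWave_mul_self`) and
  `Re⟨B†B⟩ ≥ (Σ_k ĝ_d(k) u_k v_k)² = (Φ_L/2)²` (tree: `sq_pairAmplitude_le_expect_pairOperator_sq`),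
  `Re⟨Ψ, Δ_d†Δ_d Ψ⟩ ≥ 2Φ_L²` (`two_mul_sq_sum_abs_dWaveGap_le_re_expect`);
* §3 with part 1's `Φ_L ≥ 8L²/π² − 6L`: `p_d(L; Ψ) ≥ 2(8/π² − 6/L)² ≥ 128/π⁴ − 22/L`
  (`kinematic_sub_le_pairFieldDensity`, **`exists_pairFieldDensity_ge_kinematic`**: for every `L ≥ 1` a
  unit spin-balanced `ψ` with `128/π⁴ − 22/L ≤ pairFieldDensity L ψ`), the two-sided
  `kinematicCeiling_sandwich : (∃ unit spin-balanced ψ, 128/π⁴ − 22/L ≤ p_d) ∧ (∀ unit ψ, p_d ≤ 128/π⁴ + 2736/L)`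
  (upper side = rung 0′ with the tail absorbed, `pairFieldDensity_le_kinematic_tail`), the ε-form
  `kinematicCeiling_asymptotic`, and `no_kinematic_ceiling_below`: no constant `c < 128/π⁴` bounds `p_d`
  over all unit spin-balanced states for all large `L`.

HONEST LABEL. KINEMATIC CALIBRATION, not a rung: the witness is a grand-canonical product state; nothing is
said about Hubbard (or any interacting) ground states. Part 3 transfers the witness to fixed particle-number
sectors (pigeonhole) and to the exact format of rung 0′. NOT proved (orientation only): the supremum at a
PRESCRIBED filling `δ` (the sign-twisted Dicke state suggests `128(1−δ²)/π⁴`). Literature placement: the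
trial-state (easy) half of the exactness of the BCS / approximating-Hamiltonian treatment of a separable
pairing interaction `−B†B` (Bardeen–Cooper–Schrieffer 1957 §II; Bogoliubov jr.'s approximating-Hamiltonian
method); the operator inequality (hard half) is rung 0′ itself. No published theorem is cited as a fact;
everything is proved here from the tree's definitions. [folklore]
-/

noncomputable section

namespace Summit.HubbardSuperconductivity.HubbardLadder

open Matrix Finset Literature.Probability.LatticeModels Literature.MathematicalPhysics.QuantumLattice
open Summit.HubbardSuperconductivity.TwTipContinuation.IsogapTransport
open scoped ComplexOrder ComplexConjugate

variable {L : ℕ} [NeZero L]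

/-! ### §2 The witness: the iso-gap `d`-wave BCS product state -/

/-- The coherence factor `u_k ≡ 1/√2` of the iso-gap witness. -/
def isoU (L : ℕ) : TorusSite 2 L → ℝ := fun _ => Real.sqrt 2 / 2

/-- The coherence factor `v_k = sgn(ĝ_d(k))/√2` of the iso-gap witness (sign `+` on the nodal set). -/
def isoV (L : ℕ) [NeZero L] : TorusSite 2 L → ℝ := fun k =>
  if 0 ≤ dWaveGap k then Real.sqrt 2 / 2 else -(Real.sqrt 2 / 2)

/-- **The iso-gap `d`-wave BCS product state** `Ψ_L = Π_k (1/√2 + (sgn ĝ_d(k)/√2) b†_k)|0⟩` over all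
Bloch pair levels of `(ℤ/Lℤ)²` (the `D → ∞` member of the BCS family: `u_k v_k = |…|/2` saturates
`u² + v² = 1`). [folklore] -/
def isoBCSState (L : ℕ) [NeZero L] : Fock (Orb (FermionTorus 2 L)) :=
  (List.prod (List.map (fun k =>
      (((isoU L k : ℝ) : ℂ) •
          (1 : Matrix (Finset (Orb (FermionTorus 2 L))) (Finset (Orb (FermionTorus 2 L))) ℂ) +
        ((isoV L k : ℝ) : ℂ) • (pairMode k)ᴴ))
    (Finset.univ : Finset (TorusSite 2 L)).toList)) *ᵥ (vacuum : Fock (Orb (FermionTorus 2 L)))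

/-- `(√2/2)² = 1/2`. -/
private theorem sqrt_two_div_two_sq : (Real.sqrt 2 / 2) ^ 2 = 1 / 2 := by
  rw [div_pow, Real.sq_sqrt (by norm_num : (0 : ℝ) ≤ 2)]
  norm_num

/-- Normalisation of the witness' coefficients: `u_k² + v_k² = 1`. [folklore] -/
theorem isoU_sq_add_isoV_sq : ∀ k : TorusSite 2 L, isoU L k ^ 2 + isoV L k ^ 2 = 1 := by
  intro k
  simp only [isoU, isoV]
  split_ifs with h
  · rw [sqrt_two_div_two_sq]; norm_num
  · rw [neg_sq, sqrt_two_div_two_sq]; norm_num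

/-- **The pair amplitude of the witness is `Φ_L/2`**: `Σ_k ĝ_d(k) u_k v_k = ½ Σ_k |ĝ_d(k)|`. [folklore] -/
theorem sum_dWaveGap_mul_isoU_mul_isoV :
    ∑ k : TorusSite 2 L, dWaveGap k * isoU L k * isoV L k = (∑ k : TorusSite 2 L, |dWaveGap k|) / 2 := by
  rw [Finset.sum_div]
  refine Finset.sum_congr rfl fun k _ => ?_
  simp only [isoU, isoV]
  have h2 : Real.sqrt 2 / 2 * (Real.sqrt 2 / 2) = 1 / 2 := by rw [← sq, sqrt_two_div_two_sq]
  split_ifs with h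
  · rw [abs_of_nonneg h, mul_assoc, h2]
    ring
  · rw [abs_of_neg (not_le.mp h), mul_assoc, mul_neg, h2]
    ring

/-- **The witness is a unit vector.** [folklore] -/
theorem isoBCSState_norm : star (isoBCSState L) ⬝ᵥ isoBCSState L = 1 := by
  unfold isoBCSState
  exact star_prodState_dotProduct_self (isoU L) (isoV L) isoU_sq_add_isoV_sq (Finset.nodup_toList _)

/-- **The witness is spin-balanced** (`S^z = 0`). [folklore] -/
theorem isoBCSState_mem_spinBalanced : isoBCSState L ∈ spinBalanced := by
  unfold isoBCSState
  exact prodState_mem_spinBalanced (isoU L) (isoV L) _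

/-- `Δ_dᴴ Δ_d = 8 · BᴴB` with `B = pairOperator ĝ_d univ` (`Δ_d = −2√2 B`,
`pairField_dWave_eq_smul_pairOperator`). [folklore] -/
private theorem conjTranspose_pairField_dWave_mul_self :
    (pairField dWaveFormFactor L)ᴴ * pairField dWaveFormFactor L =
      (8 : ℂ) • ((pairOperator dWaveGap (Finset.univ : Finset (TorusSite 2 L)))ᴴ *
        pairOperator dWaveGap (Finset.univ : Finset (TorusSite 2 L))) := by
  rw [pairField_dWave_eq_smul_pairOperator, conjTranspose_neg, conjTranspose_smul, neg_mul_neg,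
    smul_mul_smul_comm, Complex.star_def, Complex.conj_ofReal, ← Complex.ofReal_mul,
    show (2 * Real.sqrt 2) * (2 * Real.sqrt 2) = (8 : ℝ) by
      nlinarith [Real.mul_self_sqrt (show (0:ℝ) ≤ 2 by norm_num)]]
  norm_num

/-- **Pair intensity of the witness**: `2 Φ_L² ≤ Re⟨Ψ_L, Δ_d†Δ_d Ψ_L⟩` (`= 8·(Φ_L/2)²`). [folklore] -/
theorem two_mul_sq_sum_abs_dWaveGap_le_re_expect :
    2 * (∑ k : TorusSite 2 L, |dWaveGap k|) ^ 2 ≤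
      (star (isoBCSState L) ⬝ᵥ
        (((pairField dWaveFormFactor L)ᴴ * pairField dWaveFormFactor L) *ᵥ isoBCSState L)).re := by
  rw [conjTranspose_pairField_dWave_mul_self, smul_mulVec, dotProduct_smul, smul_eq_mul,
    show (8 : ℂ) = ((8 : ℝ) : ℂ) by norm_num, Complex.re_ofReal_mul]
  have hamp := sq_pairAmplitude_le_expect_pairOperator_sq (isoU L) (isoV L) isoU_sq_add_isoV_sq dWaveGap
  rw [sum_dWaveGap_mul_isoU_mul_isoV] at hamp
  have e : 2 * (∑ k : TorusSite 2 L, |dWaveGap k|) ^ 2 =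
      8 * ((∑ k : TorusSite 2 L, |dWaveGap k|) / 2) ^ 2 := by ring
  rw [e]
  unfold isoBCSState
  exact mul_le_mul_of_nonneg_left hamp (by norm_num)

/-! ### §3 Sharpness of the kinematic ceiling -/

/-- **Exact finite-volume floor**: `p_d(L; Ψ_L) ≥ 2 Φ_L² / L⁴` for the witness, every `L ≥ 1` — to be
compared with the ceiling `p_d(L; ψ) ≤ 8(Φ_L/2 + (3/2)εL² + (4/ε+1)(2+ε))²/L⁴` of every unit state
(`re_expect_pairField_dWave_sq_le`): same leading term `2Φ_L²/L⁴`. [folklore] -/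
theorem pairFieldDensity_isoBCSState_ge :
    2 * (∑ k : TorusSite 2 L, |dWaveGap k|) ^ 2 / (L : ℝ) ^ 4 ≤ pairFieldDensity L (isoBCSState L) := by
  obtain ⟨L', rfl⟩ : ∃ L', L = L' + 1 := ⟨L - 1, by have := NeZero.ne L; omega⟩
  rw [pairFieldDensity_succ]
  exact div_le_div_of_nonneg_right two_mul_sq_sum_abs_dWaveGap_le_re_expect (by positivity)

/-- **The arithmetic of sharpness**: a state with pair intensity `Re⟨ψ, Δ_d†Δ_d ψ⟩ ≥ 2Φ_L²` has
`p_d(L; ψ) ≥ 2Φ_L²/L⁴ ≥ 2(8/π² − 6/L)² ≥ 128/π⁴ − 22/L` (`L ≥ 1`; uses only `3 < π ≤ 4`). [folklore] -/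
theorem kinematic_sub_le_pairFieldDensity (ψ : Fock (Orb (FermionTorus 2 L)))
    (hψ : 2 * (∑ k : TorusSite 2 L, |dWaveGap k|) ^ 2 ≤
      (star ψ ⬝ᵥ (((pairField dWaveFormFactor L)ᴴ * pairField dWaveFormFactor L) *ᵥ ψ)).re) :
    128 / Real.pi ^ 4 - 22 / L ≤ pairFieldDensity L ψ := by
  have hfloor : 2 * (∑ k : TorusSite 2 L, |dWaveGap k|) ^ 2 / (L : ℝ) ^ 4 ≤ pairFieldDensity L ψ := by
    obtain ⟨L', rfl⟩ : ∃ L', L = L' + 1 := ⟨L - 1, by have := NeZero.ne L; omega⟩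
    rw [pairFieldDensity_succ]
    exact div_le_div_of_nonneg_right hψ (by positivity)
  refine le_trans ?_ hfloor
  have hpi := Real.pi_pos
  have hpi3 := Real.pi_gt_three
  have hL : (L : ℕ) ≠ 0 := NeZero.ne L
  have hLpos : (0 : ℝ) < L := by exact_mod_cast Nat.pos_of_ne_zero hL
  have hΦ := sum_abs_dWaveGap_ge (L := L)
  set Φ := ∑ k : TorusSite 2 L, |dWaveGap k| with hΦdef
  have hΦ0 : 0 ≤ Φ := Finset.sum_nonneg fun k _ => abs_nonneg _
  have ha : 8 / Real.pi ^ 2 - 6 / L ≤ Φ / (L : ℝ) ^ 2 := by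
    rw [le_div_iff₀ (by positivity)]
    have : (8 / Real.pi ^ 2 - 6 / L) * (L : ℝ) ^ 2 = 8 * (L : ℝ) ^ 2 / Real.pi ^ 2 - 6 * L := by
      field_simp
    rw [this]
    exact hΦ
  have e : 2 * Φ ^ 2 / (L : ℝ) ^ 4 = 2 * (Φ / (L : ℝ) ^ 2) ^ 2 := by
    field_simp
  rw [e]
  have hpi9 : (9 : ℝ) < Real.pi ^ 2 := by nlinarith
  have h9L : 9 * (L : ℝ) ≤ Real.pi ^ 2 * L := by nlinarith
  by_cases hcase : 0 ≤ 8 / Real.pi ^ 2 - 6 / L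
  · have hsq : (8 / Real.pi ^ 2 - 6 / L) ^ 2 ≤ (Φ / (L : ℝ) ^ 2) ^ 2 := pow_le_pow_left₀ hcase ha 2
    have hx : 192 / (Real.pi ^ 2 * L) ≤ 22 / L := by
      rw [div_le_div_iff₀ (by positivity) hLpos]
      linarith
    have e2 : 2 * (8 / Real.pi ^ 2 - 6 / L) ^ 2 =
        128 / Real.pi ^ 4 - 192 / (Real.pi ^ 2 * L) + 72 / (L : ℝ) ^ 2 := by
      field_simp
      ring
    have h72 : 0 ≤ 72 / (L : ℝ) ^ 2 := by positivity
    calc 128 / Real.pi ^ 4 - 22 / L ≤ 128 / Real.pi ^ 4 - 192 / (Real.pi ^ 2 * L) := by linarith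
      _ ≤ 2 * (8 / Real.pi ^ 2 - 6 / L) ^ 2 := by rw [e2]; linarith
      _ ≤ 2 * (Φ / (L : ℝ) ^ 2) ^ 2 := by linarith
  · -- `L < 3π²/4`: the left side is negative
    rw [not_le] at hcase
    have hlt : 8 / Real.pi ^ 2 < 6 / L := by linarith
    rw [div_lt_div_iff₀ (by positivity) hLpos] at hlt
    have hpi16 : Real.pi ^ 2 ≤ 16 := by nlinarith [Real.pi_le_four]
    have hL12 : (L : ℝ) < 12 := by nlinarith
    have hpi4 : (81 : ℝ) < Real.pi ^ 4 := by nlinarith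
    have h1 : 128 / Real.pi ^ 4 < 22 / L := by
      rw [div_lt_div_iff₀ (by positivity) hLpos]
      nlinarith
    have h2 : 0 ≤ 2 * (Φ / (L : ℝ) ^ 2) ^ 2 := by positivity
    linarith

/-- **The kinematic ceiling is attained up to `O(1/L)`**: for every `L ≥ 1` there is a unit, spin-balanced
state (`isoBCSState L`) with `p_d(L; ψ) ≥ 128/π⁴ − 22/L`. [folklore] -/
theorem exists_pairFieldDensity_ge_kinematic (L : ℕ) [NeZero L] :
    ∃ ψ : Fock (Orb (FermionTorus 2 L)), star ψ ⬝ᵥ ψ = 1 ∧ ψ ∈ spinBalanced ∧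
      128 / Real.pi ^ 4 - 22 / L ≤ pairFieldDensity L ψ :=
  ⟨isoBCSState L, isoBCSState_norm, isoBCSState_mem_spinBalanced,
    kinematic_sub_le_pairFieldDensity _ two_mul_sq_sum_abs_dWaveGap_le_re_expect⟩

/-- The upper side with the tail absorbed: `p_d(L; ψ) ≤ 128/π⁴ + 2736/L` for every unit `ψ` and every
`L ≥ 1` (`8(4/π² + 18/L)² = 128/π⁴ + 1152/(π²L) + 2592/L² ≤ 128/π⁴ + 2720/L`). [folklore] -/
theorem pairFieldDensity_le_kinematic_tail (ψ : Fock (Orb (FermionTorus 2 L))) (hψ : star ψ ⬝ᵥ ψ = 1) :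
    pairFieldDensity L ψ ≤ 128 / Real.pi ^ 4 + 2736 / L := by
  refine (pairFieldDensity_le_kinematic L ψ hψ).trans ?_
  have hpi3 := Real.pi_gt_three
  have hpi := Real.pi_pos
  have hL : (L : ℕ) ≠ 0 := NeZero.ne L
  have hL1 : (1 : ℝ) ≤ L := by exact_mod_cast Nat.one_le_iff_ne_zero.2 hL
  have hLpos : (0 : ℝ) < L := by linarith
  have e : 8 * (4 / Real.pi ^ 2 + 18 / L) ^ 2 =
      128 / Real.pi ^ 4 + 1152 / (Real.pi ^ 2 * L) + 2592 / (L : ℝ) ^ 2 := by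
    field_simp
    ring
  rw [e]
  have hpi9 : (9 : ℝ) < Real.pi ^ 2 := by nlinarith
  have h9L : 9 * (L : ℝ) ≤ Real.pi ^ 2 * L := by nlinarith
  have h1 : 1152 / (Real.pi ^ 2 * L) ≤ 128 / L := by
    rw [div_le_div_iff₀ (by positivity) hLpos]
    linarith
  have h2 : 2592 / (L : ℝ) ^ 2 ≤ 2592 / L :=
    div_le_div_of_nonneg_left (by norm_num) hLpos (by nlinarith)
  have h3 : 128 / (L : ℝ) + 2592 / L ≤ 2736 / L := by
    rw [← add_div]
    exact div_le_div_of_nonneg_right (by norm_num) hLpos.le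
  linarith

/-- **Two-sided sandwich on the kinematic supremum.** For every `L ≥ 1`: every unit state has
`p_d ≤ 128/π⁴ + 2736/L`, and some unit spin-balanced state has `p_d ≥ 128/π⁴ − 22/L`; so
`sup_{‖ψ‖=1} p_d(L; ψ) = 128/π⁴ + O(1/L)`. [folklore] -/
theorem kinematicCeiling_sandwich (L : ℕ) [NeZero L] :
    (∀ ψ : Fock (Orb (FermionTorus 2 L)), star ψ ⬝ᵥ ψ = 1 →
        pairFieldDensity L ψ ≤ 128 / Real.pi ^ 4 + 2736 / L) ∧
      ∃ ψ : Fock (Orb (FermionTorus 2 L)), star ψ ⬝ᵥ ψ = 1 ∧ ψ ∈ spinBalanced ∧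
        128 / Real.pi ^ 4 - 22 / L ≤ pairFieldDensity L ψ :=
  ⟨fun ψ hψ => pairFieldDensity_le_kinematic_tail ψ hψ, exists_pairFieldDensity_ge_kinematic L⟩

/-- **Asymptotic form**: for every `ε > 0`, from some side on, the kinematic supremum of `p_d` lies in
`[128/π⁴ − ε, 128/π⁴ + ε]` (sides written `L + 1` to keep them positive). [folklore] -/
theorem kinematicCeiling_asymptotic (ε : ℝ) (hε : 0 < ε) :
    ∃ L₀ : ℕ, ∀ L : ℕ, L₀ ≤ L →
      (∀ ψ : Fock (Orb (FermionTorus 2 (L + 1))), star ψ ⬝ᵥ ψ = 1 →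
          pairFieldDensity (L + 1) ψ ≤ 128 / Real.pi ^ 4 + ε) ∧
        ∃ ψ : Fock (Orb (FermionTorus 2 (L + 1))), star ψ ⬝ᵥ ψ = 1 ∧ ψ ∈ spinBalanced ∧
          128 / Real.pi ^ 4 - ε ≤ pairFieldDensity (L + 1) ψ := by
  obtain ⟨L₀, hL₀⟩ := exists_nat_gt (2736 / ε)
  refine ⟨L₀, fun L hL => ?_⟩
  have hLL : (L₀ : ℝ) ≤ L := by exact_mod_cast hL
  have hbig : 2736 / ε < (L : ℝ) + 1 := by linarith
  have hpos : (0 : ℝ) < (L : ℝ) + 1 := by positivity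
  have ht1 : (2736 : ℝ) / ((L + 1 : ℕ) : ℝ) < ε := by
    rw [Nat.cast_add_one, div_lt_iff₀ hpos]
    rw [div_lt_iff₀ hε] at hbig
    linarith
  have ht2 : (22 : ℝ) / ((L + 1 : ℕ) : ℝ) < ε := by
    refine lt_of_le_of_lt ?_ ht1
    exact div_le_div_of_nonneg_right (by norm_num) (by positivity)
  obtain ⟨hup, ψ, h1, h2, h3⟩ := kinematicCeiling_sandwich (L + 1)
  refine ⟨fun φ hφ => ?_, ψ, h1, h2, ?_⟩
  · have := hup φ hφ
    linarith
  · linarith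

/-- **No Hamiltonian-free ceiling below `128/π⁴`.** No constant `c < 128/π⁴` bounds the pair-field
density of all unit spin-balanced states on all large tori: the informativeness threshold `E < 128/π⁴`
of a uniform pair-field ceiling certificate (R4-MEMO §9.12) cannot be met by kinematics alone. [folklore] -/
theorem no_kinematic_ceiling_below {c : ℝ} (hc : c < 128 / Real.pi ^ 4) :
    ¬ ∃ L₀ : ℕ, ∀ L : ℕ, L₀ ≤ L → ∀ ψ : Fock (Orb (FermionTorus 2 (L + 1))),
        star ψ ⬝ᵥ ψ = 1 → ψ ∈ spinBalanced → pairFieldDensity (L + 1) ψ ≤ c := by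
  rintro ⟨L₀, h⟩
  obtain ⟨L₂, hL₂⟩ := kinematicCeiling_asymptotic ((128 / Real.pi ^ 4 - c) / 2) (by linarith)
  obtain ⟨_, φ, g1, g2, g3⟩ := hL₂ (max L₀ L₂) (le_max_right _ _)
  have g4 := h (max L₀ L₂) (le_max_left _ _) φ g1 g2
  linarith

end Summit.HubbardSuperconductivity.HubbardLadder
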